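import Literature.Claims.NS.Jennings2020
import Literature.Analysis.FluidPDE.KNSSLocalSmoothingHolds
import HarnessLib

/-!
# Solo salvage for claim C20 `Jennings2020` (cell `ns-claims`, D-0090): the dilation bookkeeping of the
# data class (Step 1), kernel-discharged

Claim skeleton: `Literature/Claims/NS/Jennings2020.lean` (typist `ns-claims-typist-6`, p469733): G. Jennings,
arXiv:2002.08270 v6, Thm 11.1 p.131 («Option A»); the candidate locator is the scaling rule L9.1 (9.4)
p.109–110 (`Step6_ScalingRule` / `Step6b_JDilation`, refuter-1's lane), whose content is the behaviour of the
regularised equation (7.1) under the Navier–Stokes dilation `u ↦ α u(α x, α² t)`.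

This file (seat `ns-claims-salvage-p2`, salvage lane of C20) discharges the dilation steps that ARE true:

* `step1_holds : Step1_DataDilation` — p.109 l.7280–7283 «we let (9.3) `u_o^α(x) := α u_o(xα)` which the
  chain rule shows is `∈ ∩_m H^{m,df}`» (and `u_o(xν)` of (11.1) p.131): for `a ≠ 0` and any `c`, the dilated
  datum `x ↦ c • u₀(a • x)` is again `C^∞`, has every derivative in `L²` (`‖Dⁿ[u₀(a·)](x)‖ ≤ |a|ⁿ‖Dⁿu₀(ax)‖`,
  tree `norm_iteratedFDeriv_comp_smul_le`, and the Haar change of variables `∫ g(ax) dx = |a|⁻³ ∫ g`), and is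
  divergence free (`div[c u₀(a·)](x) = c a (div u₀)(ax)`). Original source: the chain rule; not the claim.
* `step6c_holds : Step6c_PlDilation` — (9.6)→(9.7) p.110: the typed projector `P_l w = w − ∇N(div w)`
  (Newtonian potential `N`) commutes with dilations `x ↦ αx`, `α > 0`: Haar change of variables in the Bochner
  integral (`Measure.integral_comp_smul`, junk-consistent, no integrability needed) and the chain rule for
  `div`/`∇` (`fderiv_comp_smul`, junk-consistent). Original source: degree-zero homogeneity of the Leray
  projector (Riesz transforms), not the claim. The companion `Step6b_JDilation` (fixed-scale mollifier under
  dilation) is refuter-1's target: dilation conjugates `J_γ` into `J_{γα}`, not into `J_γ`.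

Solo lane (`Theorems/SoloSalvage<Slug>.lean`, no item).

WHAT THIS IS NOT: not a claim about NS regularity or blow-up; not a claim about any author beyond the
typed locator.
-/

noncomputable section

open Set MeasureTheory Function
open scoped ENNReal ContDiff

-- The mandated landing namespace repeats the summit name by design (D-0017).
set_option linter.dupNamespace false

namespace Summit.NavierStokesRegularity.NavierStokesRegularity.Theorems

namespace Jennings2020

open Literature.Claims.NS.Jennings2020 Literature.Analysis Literature.Analysis.FluidPDE

/-- Haar change of variables on `ℝ³` for lower integrals: `∫⁻ g(a • x) dx = |(a³)⁻¹| ∫⁻ g` for `a ≠ 0`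
(Mathlib `Measure.map_addHaar_smul`). [folklore] -/
private theorem lintegral_comp_smul_R3 (g : E3 → ℝ≥0∞) {a : ℝ} (ha : a ≠ 0) :
    ∫⁻ x, g (a • x) = ENNReal.ofReal |(a ^ Module.finrank ℝ E3)⁻¹| * ∫⁻ x, g x := by
  calc ∫⁻ x, g (a • x) = ∫⁻ y, g y ∂(Measure.map (a • ·) volume) :=
        (lintegral_map_equiv g (Homeomorph.smul (isUnit_iff_ne_zero.2 ha).unit).toMeasurableEquiv).symm
    _ = ENNReal.ofReal |(a ^ Module.finrank ℝ E3)⁻¹| * ∫⁻ x, g x := by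
        rw [Measure.map_addHaar_smul volume ha, lintegral_smul_measure, smul_eq_mul]

/-- **Step 1 HOLDS (p.109 l.7280–7283, (9.3); (11.1) p.131)**: the data class `∩_m H^{m,df}` (`C^∞`, every
derivative in `L²`, divergence free) is invariant under `u₀ ↦ c • u₀(a •)`, `a ≠ 0` — the chain rule, as the
paper says. [cite: Jennings2020, (9.3) p.109, (11.1) p.131] -/
theorem step1_holds : Literature.Claims.NS.Jennings2020.Step1_DataDilation := by
  intro c a ha u₀ hu
  obtain ⟨hsmooth, hH, hdiv⟩ := hu
  -- smoothness
  have hcomp : ContDiff ℝ (⊤ : ℕ∞) (fun x : E3 => u₀ (a • x)) := hsmooth.comp (contDiff_id.const_smul a)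
  have hsmooth' : ContDiff ℝ (⊤ : ℕ∞) (dilData c a u₀) := hcomp.const_smul c
  refine ⟨hsmooth', ?_, ?_⟩
  · -- every derivative in `L²`
    intro n
    have hcompn : ContDiff ℝ n (fun x : E3 => u₀ (a • x)) := hcomp.of_le (by exact_mod_cast le_top)
    -- pointwise bound on the iterated derivative
    have hpt : ∀ x : E3, ‖iteratedFDeriv ℝ n (dilData c a u₀) x‖ₑ ≤
        ENNReal.ofReal (|c| * |a| ^ n) * ‖iteratedFDeriv ℝ n u₀ (a • x)‖ₑ := by
      intro x
      have h1 : iteratedFDeriv ℝ n (dilData c a u₀) x = c • iteratedFDeriv ℝ n (fun y : E3 => u₀ (a • y)) x := by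
        unfold dilData
        exact iteratedFDeriv_const_smul_apply' (hcompn.contDiffAt)
      have h2 := norm_iteratedFDeriv_comp_smul_le u₀ ha n x
      rw [← ofReal_norm, ← ofReal_norm, h1, norm_smul, Real.norm_eq_abs,
        ← ENNReal.ofReal_mul (by positivity)]
      refine ENNReal.ofReal_le_ofReal ?_
      calc |c| * ‖iteratedFDeriv ℝ n (fun y : E3 => u₀ (a • y)) x‖
          ≤ |c| * (|a| ^ n * ‖iteratedFDeriv ℝ n u₀ (a • x)‖) :=
            mul_le_mul_of_nonneg_left h2 (abs_nonneg c)
        _ = |c| * |a| ^ n * ‖iteratedFDeriv ℝ n u₀ (a • x)‖ := by ring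
    calc ∫⁻ x, ‖iteratedFDeriv ℝ n (dilData c a u₀) x‖ₑ ^ 2
        ≤ ∫⁻ x, (ENNReal.ofReal (|c| * |a| ^ n) * ‖iteratedFDeriv ℝ n u₀ (a • x)‖ₑ) ^ 2 :=
          lintegral_mono fun x => pow_le_pow_left' (hpt x) 2
      _ = ENNReal.ofReal (|c| * |a| ^ n) ^ 2 * ∫⁻ x, ‖iteratedFDeriv ℝ n u₀ (a • x)‖ₑ ^ 2 := by
          simp_rw [mul_pow]
          rw [lintegral_const_mul' _ _ (ENNReal.pow_ne_top ENNReal.ofReal_ne_top)]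
      _ = ENNReal.ofReal (|c| * |a| ^ n) ^ 2 * (ENNReal.ofReal |(a ^ Module.finrank ℝ E3)⁻¹| *
            ∫⁻ x, ‖iteratedFDeriv ℝ n u₀ x‖ₑ ^ 2) := by
          rw [lintegral_comp_smul_R3 (fun y => ‖iteratedFDeriv ℝ n u₀ y‖ₑ ^ 2) ha]
      _ < ⊤ := ENNReal.mul_lt_top (ENNReal.pow_lt_top ENNReal.ofReal_lt_top)
          (ENNReal.mul_lt_top ENNReal.ofReal_lt_top (hH n))
  · -- divergence free
    intro x
    have hd : DifferentiableAt ℝ (fun y : E3 => u₀ (a • y)) x := (hcomp.differentiable (by simp)) x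
    show LinearMap.trace ℝ E3 (fderiv ℝ (dilData c a u₀) x : E3 →ₗ[ℝ] E3) = 0
    have hf : fderiv ℝ (dilData c a u₀) x = c • (a • fderiv ℝ u₀ (a • x)) := by
      unfold dilData
      rw [fderiv_fun_const_smul hd, fderiv_comp_smul]
    rw [hf, ContinuousLinearMap.toLinearMap_smul, ContinuousLinearMap.toLinearMap_smul, map_smul, map_smul]
    have := hdiv (a • x)
    unfold NSWave0.divergence at this
    rw [this, smul_zero, smul_zero]

/-! ### Step 6c: dilation covariance of the typed Helmholtz–Hodge projector -/

/-- The divergence of a dilated field: `div[w(α·)](y) = α (div w)(αy)` (chain rule; no differentiability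
hypothesis, `fderiv_comp_smul`). [folklore] -/
private theorem divergence_comp_smul (w : E3 → E3) (α : ℝ) :
    VectorCalculus.divergence (fun x : E3 => w (α • x)) = fun y => α * VectorCalculus.divergence w (α • y) := by
  funext y
  unfold VectorCalculus.divergence
  have h : fderiv ℝ (fun x : E3 => w (α • x)) y = α • fderiv ℝ w (α • y) := fderiv_comp_smul α
  rw [h, ContinuousLinearMap.toLinearMap_smul, map_smul, smul_eq_mul]

/-- The typed Newtonian potential of `y ↦ α g(αy)` is `x ↦ α⁻¹ (N g)(αx)` for `α > 0` (Haar change of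
variables `y = α⁻¹z` in the Bochner integral, no integrability hypothesis: Mathlib
`Measure.integral_comp_smul`; `|x − α⁻¹z| = α⁻¹|αx − z|`). [folklore] -/
private theorem newton_dilate (g : E3 → ℝ) {α : ℝ} (hα : 0 < α) :
    newton (fun y : E3 => α * g (α • y)) = fun x => α⁻¹ * newton g (α • x) := by
  funext x
  unfold newton
  set F : E3 → ℝ := fun z => -(4 * Real.pi * ‖x - α⁻¹ • z‖)⁻¹ * (α * g z) with hF
  have hαne : α ≠ 0 := hα.ne'
  have h1 : (fun y : E3 => -(4 * Real.pi * ‖x - y‖)⁻¹ * (α * g (α • y))) = fun y => F (α • y) := by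
    funext y
    simp only [hF, smul_smul, inv_mul_cancel₀ hαne, one_smul]
  rw [h1, Measure.integral_comp_smul volume F α]
  have hd : Module.finrank ℝ E3 = 3 := finrank_euclideanSpace_fin
  rw [hd]
  -- `F z = α² · (−(4π|αx − z|)⁻¹ g z)`
  have h2 : F = fun z => α ^ 2 * (-(4 * Real.pi * ‖α • x - z‖)⁻¹ * g z) := by
    funext z
    have hn : ‖x - α⁻¹ • z‖ = α⁻¹ * ‖α • x - z‖ := by
      have : x - α⁻¹ • z = α⁻¹ • (α • x - z) := by
        rw [smul_sub, smul_smul, inv_mul_cancel₀ hαne, one_smul]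
      rw [this, norm_smul, Real.norm_eq_abs, abs_of_pos (inv_pos.2 hα)]
    simp only [hF, hn]
    rw [show 4 * Real.pi * (α⁻¹ * ‖α • x - z‖) = α⁻¹ * (4 * Real.pi * ‖α • x - z‖) by ring,
      mul_inv, inv_inv]
    ring
  rw [h2, integral_const_mul, smul_eq_mul, abs_of_pos (by positivity)]
  field_simp

/-- The gradient of `x ↦ α⁻¹ N(αx)` at `x` is `(∇N)(αx)` — with matching junk values (the composite is
differentiable at `x` iff `N` is at `αx`). [folklore] -/
private theorem gradient_inv_mul_comp_smul (N : E3 → ℝ) {α : ℝ} (hα : 0 < α) (x : E3) :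
    gradient (fun y : E3 => α⁻¹ * N (α • y)) x = gradient N (α • x) := by
  have hαne : α ≠ 0 := hα.ne'
  haveI : Invertible (α⁻¹) := invertibleOfNonzero (inv_ne_zero hαne)
  unfold gradient
  congr 1
  have hfun : (fun y : E3 => α⁻¹ * N (α • y)) = α⁻¹ • fun y : E3 => N (α • y) := by
    funext y; simp [smul_eq_mul]
  rw [hfun, fderiv_const_smul_of_invertible, fderiv_comp_smul α, smul_smul, inv_mul_cancel₀ hαne, one_smul]

/-- **Step 6c HOLDS ((9.6)→(9.7) p.110, «(4.14) shows»)**: the typed Helmholtz–Hodge projector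
`P_l w = w − ∇N(div w)` commutes with dilations, `P_l[x ↦ w(αx)] = x ↦ (P_l w)(αx)` (`α > 0`), by the change
of variables in the Newtonian potential and the chain rule — a degree-zero operator (Lemarié-Rieusset 2002
Ch. 11; Stein 1970 Ch. III). The smoothness / `∩ₘHᵐ` / integrability hypotheses of the typed step are not
needed. [cite: Jennings2020, (9.6)–(9.7) p.110, (4.14) p.36] -/
theorem step6c_holds : Literature.Claims.NS.Jennings2020.Step6c_PlDilation := by
  intro α hα w _ _ _
  funext x
  unfold lerayProj
  rw [divergence_comp_smul w α, newton_dilate _ hα, gradient_inv_mul_comp_smul _ hα]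

end Jennings2020

end Summit.NavierStokesRegularity.NavierStokesRegularity.Theorems
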